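import Summits.AtomisticToContinuum.FouriersLaw.Theorems.HoelderEscapeProfileAbelSpreadCeilingPerSiteHelfand
import Summits.AtomisticToContinuum.FouriersLaw.Theorems.HoelderEscapeProfileAbelSpreadCeilingFixedTimeRegularity
import Summits.AtomisticToContinuum.FouriersLaw.Theorems.HoelderEscapeProfileAbelSpreadCeilingAbelExchangeToolkit
import HarnessLib

/-!
# Stub `stub_helfandMoment` of line `SpikeLemma`, crux `CoercivePulse.LinearCeiling`
(item stmt-AtomisticToContinuum-15383; `--supports` file, closes nothing; line lead, 2026-08-17)

WHAT. Registered stub 4 of the crux's skeleton (`Cruxes/LinearCeiling/Lines/SpikeLemma.lean`): HELFAND'S IDENTITY FOR THE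
HELFAND MOMENT, TIME DOMAIN. For the pinned anharmonic chain `pinnedChain ω₂ lam β γ` (`ω₂, lam, β > 0`), the shift- and
momentum-reversal-invariant DLR state `μ` at `T > 0`, ANY `μ`-preserving dynamics `D` commuting a.e. with the shift, the
split-bond site energy `h_x`, the pulse `S(x,t) = Cov_μ(h_0, h_x ∘ φ_t)` with `Σ_x (1+x²)|S(x,t)| < ∞` at every `t`, and the
summed current autocorrelation `C_T = D.currentCorrelation μ`:
`Σ_x x² S(x,t) − Σ_x x² S(x,0) = 2 ∫_{(0,t]} (t − u) C_T(u) du` for every `t > 0`.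

HOW (everything is in the tree). (1) the landed per-site twice-integrated conservation law
`S(x,t) − S(x,0) = ∫_{(0,t]} (t−u) (ΔG)(x,u) du` (`AbelSpreadCeiling.RegularityCollapse.stub_perSiteHelfand`, with
`G(x,u) = ∫ j_0 (j_x ∘ φ_u) dμ`); (2) the cut-off weights `c_L` of the Abel-exchange toolkit (`c_L = x²` on `|x| ≤ L`,
`|c_L| ≤ 11x²`, `|Δc_L| ≤ 10`, `Δc_L → 2`, finite support) and summation by parts:
`Σ_x c_L(x)(S(x,t) − S(x,0)) = ∫_{(0,t]} (t−u) g_L(u) du`, `g_L(u) = Σ_x (Δc_L)(x) G(x,u)`; (3) `L → ∞`: on the left by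
Tannery in `x` (`tendsto_tsum_cutoff_mul`, the crux's summability hypothesis at `t` and at `0`), on the right by dominated
convergence in `u` — pointwise `g_L(u) → 2 Σ_x G(x,u) = 2 C_T(u)` (Tannery, `Σ_x |G(x,u)| < ∞` from
`stub_fixedTimeRegularity`), dominated by `10 t Σ_x m_x` through the window-uniform summable clustering majorant
`|G(x,u)| ≤ m_x` (`|u| ≤ t`) of the canonical Buttà–Marchioro twin
(`stub_canonicalTwin` + `HeatVarianceCalculus.CanonicalRigidity.stub_canonicalClusteringMajorant`, transferred along the
a.e. equality of the flows).
-/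

noncomputable section

namespace Summit.AtomisticToContinuum.FouriersLaw.Theorems.LinearCeiling.SpikeLemma

open MeasureTheory Filter Set Function
open scoped Topology BigOperators
open Literature.MathematicalPhysics.KineticTheory.HeatConduction
open Summit.AtomisticToContinuum.FouriersLaw.Theorems.AbelSpreadCeiling.RegularityCollapse

/-- **Stub `stub_helfandMoment` (registered signature, verbatim): Helfand's identity for the Helfand moment in the
time domain**, `M(t) − M(0) = 2∫_{(0,t]} (t−u) C_T(u) du` for `t > 0`, along ANY `μ`-preserving dynamics of the pinned
anharmonic chain in its shift- and reversal-invariant DLR state, under `Σ_x (1+x²)|S(x,t)| < ∞` at every `t`.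
[cite: Helfand1960, §II] [cite: BonettoLebowitzReyBellet2000, §6.3] -/
theorem stub_helfandMoment :
    ∀ ω₂ lam β γ : ℝ, 0 < ω₂ → 0 < lam → 0 < β → ∀ T : ℝ, 0 < T → ∀ μ : MeasureTheory.Measure Literature.MathematicalPhysics.KineticTheory.HeatConduction.ChainConfig, (Literature.MathematicalPhysics.KineticTheory.HeatConduction.pinnedChain ω₂ lam β γ).IsChainGibbsMeasure T μ → Literature.MathematicalPhysics.KineticTheory.HeatConduction.IsShiftInvariant μ → μ.map (fun σ : Literature.MathematicalPhysics.KineticTheory.HeatConduction.ChainConfig => fun x : ℤ => ((σ x).1, -(σ x).2)) = μ → ∀ D : Literature.MathematicalPhysics.KineticTheory.HeatConduction.InfiniteChainDynamics (Literature.MathematicalPhysics.KineticTheory.HeatConduction.pinnedChain ω₂ lam β γ), D.PreservesMeasure μ → (∀ t : ℝ, ∀ᵐ σ ∂μ, D.flow t (Literature.MathematicalPhysics.KineticTheory.HeatConduction.shift σ) = Literature.MathematicalPhysics.KineticTheory.HeatConduction.shift (D.flow t σ)) → ∀ h : Literature.MathematicalPhysics.KineticTheory.HeatConduction.ChainConfig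 → ℤ → ℝ, h = (fun (σ : Literature.MathematicalPhysics.KineticTheory.HeatConduction.ChainConfig) (x : ℤ) => (σ x).2 ^ 2 / 2 + (Literature.MathematicalPhysics.KineticTheory.HeatConduction.pinnedChain ω₂ lam β γ).U (σ x).1 + ((Literature.MathematicalPhysics.KineticTheory.HeatConduction.pinnedChain ω₂ lam β γ).V ((σ (x + 1)).1 - (σ x).1) + (Literature.MathematicalPhysics.KineticTheory.HeatConduction.pinnedChain ω₂ lam β γ).V ((σ x).1 - (σ (x - 1)).1)) / 2) → ∀ S : ℤ → ℝ → ℝ, S = (fun (x : ℤ) (t : ℝ) => ∫ σ, (h σ 0 - ∫ σ', h σ' 0 ∂μ) * (h (D.flow t σ) x - ∫ σ', h σ' 0 ∂μ) ∂μ) → (∀ t : ℝ, Summable (fun x : ℤ => (1 + (x : ℝ) ^ 2) * |S x t|)) → ∀ t : ℝ, 0 < t → (∑' x : ℤ, (x : ℝ) ^ 2 * S x t) - (∑' x : ℤ, (x : ℝ) ^ 2 * S x 0) = 2 * ∫ u in Set.Ioc (0:ℝ) t, (t - u) * D.currentCorrelation μ u := by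
  intro ω₂ lam β γ hω hl hβ T hT μ hG hSI hR D hP hSh h hh S hS hSum t ht
  -- the current pair correlations `G(x,u) = ∫ j_0 (j_x ∘ φ_u) dμ`
  obtain ⟨G, hGdef⟩ : ∃ G : ℤ → ℝ → ℝ, G = fun (x : ℤ) (u : ℝ) =>
      ∫ σ, (pinnedChain ω₂ lam β γ).bondCurrentZ σ 0 * (pinnedChain ω₂ lam β γ).bondCurrentZ (D.flow u σ) x ∂μ :=
    ⟨_, rfl⟩
  have hC : ∀ u : ℝ, D.currentCorrelation μ u = ∑' x : ℤ, G x u := fun u => by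
    rw [hGdef]; rfl
  -- (1) the per-site twice-integrated conservation law and the fixed-time regularities (landed)
  have hHelf := stub_perSiteHelfand ω₂ lam β γ hω hl hβ T hT μ hG hSI hR D hP hSh h hh S hS G hGdef
  obtain ⟨hS0, hGc, hGs⟩ := stub_fixedTimeRegularity ω₂ lam β γ hω hl hβ T hT μ hG hSI hR D hP hSh h hh S hS G hGdef
  -- the window-uniform summable majorant of `G` on `|u| ≤ t` (canonical twin + clustering majorant)
  obtain ⟨m, hm, hmaj⟩ : ∃ m : ℤ → ℝ, Summable m ∧ ∀ u : ℝ, |u| ≤ t → ∀ x : ℤ, |G x u| ≤ m x := by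
    obtain ⟨D', hcar, hmeas, hid, -, hae, -, -⟩ := stub_canonicalTwin ω₂ lam β γ hω hl hβ T hT μ hG hSI hR D hP
    obtain ⟨m, hm, hb⟩ :=
      Summit.AtomisticToContinuum.FouriersLaw.Theorems.HeatVarianceCalculus.CanonicalRigidity.stub_canonicalClusteringMajorant
        ω₂ lam β γ hω hl hβ T hT μ hG hSI hR D' hcar hmeas hid t
    refine ⟨m, hm, fun u hu x => ?_⟩
    have hGx : G x u = ∫ σ, (pinnedChain ω₂ lam β γ).bondCurrentZ σ 0 *
        (pinnedChain ω₂ lam β γ).bondCurrentZ (D'.flow u σ) x ∂μ := by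
      rw [hGdef]
      refine integral_congr_ae ?_
      filter_upwards [hae u] with σ hσ
      rw [hσ]
    rw [hGx]
    exact hb u hu x
  have hm0 : ∀ x : ℤ, 0 ≤ m x := fun x => (abs_nonneg _).trans (hmaj 0 (by rw [abs_zero]; exact ht.le) x)
  -- (2) the cut-off weights and the finite current sums `g_L(u) = Σ_x (Δc_L)(x) G(x,u)`
  obtain ⟨c, hc_sq, hc_abs, hc_lap, hc_lap2, hc_supp⟩ := AbelExchange.exists_cutoff
  obtain ⟨g, hgdef⟩ : ∃ g : ℕ → ℝ → ℝ, g = fun (L : ℕ) (u : ℝ) =>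
      ∑ x ∈ Finset.Icc (-((4 * L + 2 : ℕ) : ℤ)) ((4 * L + 2 : ℕ) : ℤ),
        (c L (x + 1) - 2 * c L x + c L (x - 1)) * G x u := ⟨_, rfl⟩
  have hgc : ∀ L : ℕ, Continuous (g L) := fun L => by
    rw [hgdef]
    exact continuous_finsetSum _ fun x _ => continuous_const.mul (hGc x)
  -- Step A: the cut-off identity `Σ_x c_L(x)(S(x,t) − S(x,0)) = ∫_{(0,t]} (t−u) g_L(u) du`
  have stepA : ∀ L : ℕ, ∑' x : ℤ, c L x * (S x t - S x 0) = ∫ u in Ioc (0:ℝ) t, (t - u) * g L u := by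
    intro L
    have hInt : ∀ x : ℤ, IntegrableOn
        (fun u : ℝ => (t - u) * (c L x * (G (x + 1) u - 2 * G x u + G (x - 1) u))) (Ioc 0 t) := by
      intro x
      have hcont : Continuous fun u : ℝ => (t - u) * (c L x * (G (x + 1) u - 2 * G x u + G (x - 1) u)) :=
        (continuous_const.sub continuous_id).mul (continuous_const.mul
          (((hGc (x + 1)).sub (continuous_const.mul (hGc x))).add (hGc (x - 1))))
      exact hcont.integrableOn_Icc.mono_set Ioc_subset_Icc_self
    calc ∑' x : ℤ, c L x * (S x t - S x 0)
        = ∑ x ∈ Finset.Icc (-((4 * L + 2 : ℕ) : ℤ)) ((4 * L + 2 : ℕ) : ℤ), c L x * (S x t - S x 0) :=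
          tsum_eq_sum fun x hx => by rw [(hc_supp L x hx).1, zero_mul]
      _ = ∑ x ∈ Finset.Icc (-((4 * L + 2 : ℕ) : ℤ)) ((4 * L + 2 : ℕ) : ℤ),
            ∫ u in Ioc (0:ℝ) t, (t - u) * (c L x * (G (x + 1) u - 2 * G x u + G (x - 1) u)) := by
          refine Finset.sum_congr rfl fun x _ => ?_
          rw [hHelf x t ht, ← integral_const_mul]
          exact integral_congr_ae (Eventually.of_forall fun u => by ring)
      _ = ∫ u in Ioc (0:ℝ) t, ∑ x ∈ Finset.Icc (-((4 * L + 2 : ℕ) : ℤ)) ((4 * L + 2 : ℕ) : ℤ),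
            (t - u) * (c L x * (G (x + 1) u - 2 * G x u + G (x - 1) u)) :=
          (integral_finsetSum _ fun x _ => hInt x).symm
      _ = ∫ u in Ioc (0:ℝ) t, (t - u) * g L u := by
          refine integral_congr_ae (Eventually.of_forall fun u => ?_)
          rw [hgdef]
          beta_reduce
          rw [← Finset.mul_sum, AbelExchange.sum_mul_laplacian_eq (hc_supp L) (fun y => G y u)]
  -- Step B (left): `Σ_x c_L(x)(S(x,t) − S(x,0)) → M(t) − M(0)` (Tannery in `x`)
  have stepBl : Tendsto (fun L : ℕ => ∑' x : ℤ, c L x * (S x t - S x 0)) atTop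
      (𝓝 ((∑' x : ℤ, (x : ℝ) ^ 2 * S x t) - ∑' x : ℤ, (x : ℝ) ^ 2 * S x 0)) := by
    have h1 := AbelExchange.tendsto_tsum_cutoff_mul c hc_sq hc_abs (hSum t)
    have h0 := AbelExchange.tendsto_tsum_cutoff_mul c hc_sq hc_abs (hSum 0)
    refine (h1.sub h0).congr fun L => ?_
    have hs : ∀ s : ℝ, Summable fun x : ℤ => c L x * S x s := fun s =>
      summable_of_ne_finset_zero (s := Finset.Icc (-((4 * L + 2 : ℕ) : ℤ)) ((4 * L + 2 : ℕ) : ℤ))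
        fun x hx => by rw [(hc_supp L x hx).1, zero_mul]
    rw [← (hs t).tsum_sub (hs 0)]
    exact tsum_congr fun x => by ring
  -- Step B (right): `∫_{(0,t]} (t−u) g_L(u) du → ∫_{(0,t]} (t−u) (2 C_T(u)) du` (dominated convergence in `u`)
  have stepBr : Tendsto (fun L : ℕ => ∫ u in Ioc (0:ℝ) t, (t - u) * g L u) atTop
      (𝓝 (∫ u in Ioc (0:ℝ) t, (t - u) * (2 * D.currentCorrelation μ u))) := by
    have hK0 : 0 ≤ ∑' x : ℤ, m x := tsum_nonneg hm0
    refine tendsto_integral_of_dominated_convergence (fun _ => t * (10 * ∑' x : ℤ, m x))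
      (fun L => ((continuous_const.sub continuous_id).mul (hgc L)).aestronglyMeasurable) (integrable_const _)
      (fun L => ?_) (Eventually.of_forall fun u => ?_)
    · -- domination on `(0,t]` through the window-uniform majorant
      filter_upwards [ae_restrict_mem measurableSet_Ioc] with u hu
      rw [Real.norm_eq_abs, abs_mul]
      have hu' : |u| ≤ t := by rw [abs_of_pos hu.1]; exact hu.2
      have h1 : |t - u| ≤ t := by
        rw [abs_of_nonneg (by linarith [hu.2])]
        linarith [hu.1]
      have h2 : |g L u| ≤ 10 * ∑' x : ℤ, m x := by
        rw [hgdef]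
        calc |∑ x ∈ Finset.Icc (-((4 * L + 2 : ℕ) : ℤ)) ((4 * L + 2 : ℕ) : ℤ),
                (c L (x + 1) - 2 * c L x + c L (x - 1)) * G x u|
            ≤ ∑ x ∈ Finset.Icc (-((4 * L + 2 : ℕ) : ℤ)) ((4 * L + 2 : ℕ) : ℤ),
                |(c L (x + 1) - 2 * c L x + c L (x - 1)) * G x u| := Finset.abs_sum_le_sum_abs _ _
          _ ≤ ∑ x ∈ Finset.Icc (-((4 * L + 2 : ℕ) : ℤ)) ((4 * L + 2 : ℕ) : ℤ), 10 * m x :=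
              Finset.sum_le_sum fun x _ => by
                rw [abs_mul]
                exact mul_le_mul (hc_lap L x) (hmaj u hu' x) (abs_nonneg _) (by norm_num)
          _ = 10 * ∑ x ∈ Finset.Icc (-((4 * L + 2 : ℕ) : ℤ)) ((4 * L + 2 : ℕ) : ℤ), m x := by
              rw [Finset.mul_sum]
          _ ≤ 10 * ∑' x : ℤ, m x := by
              have := hm.sum_le_tsum (Finset.Icc (-((4 * L + 2 : ℕ) : ℤ)) ((4 * L + 2 : ℕ) : ℤ))
                fun x _ => hm0 x
              linarith
      exact mul_le_mul h1 h2 (abs_nonneg _) ht.le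
    · -- pointwise limit `g_L(u) → 2 C_T(u)` (Tannery in `x`)
      have hlim : Tendsto (fun L : ℕ => g L u) atTop (𝓝 (2 * D.currentCorrelation μ u)) := by
        rw [hC u, ← tsum_mul_left]
        have e : ∀ L : ℕ, g L u = ∑' x : ℤ, (c L (x + 1) - 2 * c L x + c L (x - 1)) * G x u := fun L => by
          rw [hgdef]
          exact (tsum_eq_sum fun x hx => by
            rw [(hc_supp L x hx).1, (hc_supp L x hx).2.1, (hc_supp L x hx).2.2]; ring).symm
        simp only [e]
        refine tendsto_tsum_of_dominated_convergence (bound := fun x => 10 * |G x u|) ((hGs u).mul_left 10)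
          (fun x => ?_) (Eventually.of_forall fun L x => ?_)
        · refine tendsto_nhds_of_eventually_eq ?_
          filter_upwards [eventually_ge_atTop (x.natAbs + 1)] with L hL
          rw [hc_lap2 L x (by omega) (by omega)]
        · rw [Real.norm_eq_abs, abs_mul]
          exact mul_le_mul_of_nonneg_right (hc_lap L x) (abs_nonneg _)
      exact hlim.const_mul (t - u)
  -- conclusion: both sides of Step A converge; limits are unique
  have hlim := tendsto_nhds_unique stepBl (stepBr.congr' (Eventually.of_forall fun L => (stepA L).symm))
  rw [hlim, ← integral_const_mul]
  refine integral_congr_ae (Eventually.of_forall fun u => ?_)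
  ring

end Summit.AtomisticToContinuum.FouriersLaw.Theorems.LinearCeiling.SpikeLemma

end
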